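import Mathlib
import Summits.Ventures.FusionMHD.Models.RwmFRS1Kq07RateSharp
import Summits.Ventures.FusionMHD.Models.RwmFRS1Kq07M3Energy
import HarnessLib

/-!
# F3.r4: «margin for configuration E against CLASS C» with a TWO-MODE class — MODEL M_RWM,K (★ #95's `KinkEqQ07.hlK`,
# `q_a = 7/5`) against C = {(2,1), (3,1)}: the no-wall criterion FAILS on C (the (2,1) member), the ideal-wall criterion
# HOLDS on C with a certified positive margin for every wall `a < b ≤ 3/2·a`, and fails again for `b ≥ 7/4·a`

LADDER-GRIDFUSION rung F3, model row 6 («what “margin m for configuration E against class C” means as a typed Prop»,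
`Models/ResistiveSchemas.lean`: `MarginSchema`, `HasMargin`, `CriterionHolds`, `HasPositiveMargin`, `rwmNoWallSchema`,
`rwmIdealWallSchema`).  Every earlier F3.r4 row instantiated the schemas on a ONE-element class.  This file (model-6 g8) is
the first instance with `|C| > 1`, BY NAME from two accepted rows about the SAME equilibrium: ★ #109 «F3.r4-KINKEQ-RWM21»
(`RwmFRS1Kq07Energy` / `…RateSharp`: external `(2,1)` of M_RWM,K — `Kq07.dWinf_neg`, `Kq07.dWb_pos_iff`,
`Kq07.criticalWallRadius_bounds_sharp` `31/20 < b*/a < 8/5`, `Kq07.dWb_neg_far` for `b ≥ 7/4`) and its companion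
«#109′ (3,1)-POSITIVE» (`RwmFRS1Kq07M3Energy`: `Kq07M3.dWinf_pos`, `Kq07M3.dWb_pos` for every `b > a`).

CERTIFIED SENTENCES (three columns; MODEL M_RWM,K = exact force-balanced `q₀ = 7/10` screw pinch + vacuum + wall, `R₀ = 5a`;
CLASS C = the two external helicities `(2,1)` and `(3,1)` — `q_a = 7/5 < 2 < 3`, neither resonant in the plasma):
* `classData b` — the `RWMData` of M_RWM,K on C with the wall at `b`: `δW_∞` and `δW_b` per mode (the two rows' energies);
* **`noWall_not_criterionHolds`** — the printed no-wall criterion «`δW_∞ > 0` for every mode of C» FAILS (the `(2,1)` member has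
  `δW_∞ < 0`; the `(3,1)` member alone would pass: `noWall_31_pos`);
* **`idealWall_criterionHolds`** (`1 < b ≤ 3/2`) and **`idealWall_hasPositiveMargin`**: with a perfectly conducting wall at
  any `a < b ≤ 3/2·a` BOTH modes have positive ideal-wall energy, with the explicit margin `m = min(δW_b^{(2,1)}, δW_b^{(3,1)}) > 0`;
  **`idealWall_criterionHolds_iff`** (`1 < b`): the criterion holds on C iff `b < b*_{(2,1)}` (the `(3,1)` member never binds)
  ⇒ by ★ #109″'s bracket it holds for every `b ≤ 31/20·a` and FAILS for every `b ≥ 8/5·a` (`idealWall_not_criterionHolds_far`).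
HONESTY: a class of two EXTERNAL helicities; the internal `(1,1)` kink of the same model is CERTIFIED UNSTABLE (★ #95) and is not
a member of C — juxtaposed, never merged; ideal wall, no rotation; nothing about a device. [instance data]
-/

noncomputable section

open Set Literature.MathematicalPhysics.MHD Literature.MathematicalPhysics.MHD.ScrewPinch

namespace Summit.Ventures.FusionMHD.Models

namespace RwmFRS1

namespace Kq07Class

/-- The RWM data of MODEL M_RWM,K on the TWO-MODE class C = {(2,1), (3,1)} with the wall at `r = b`: per mode the no-wall and
ideal-wall reference energies of the respective marginal solutions (★ #109 / «#109′»). [instance data] -/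
def classData (b : ℝ) : ResistiveSchemas.RWMData (ℕ × ℕ) :=
  ⟨{(2, 1), (3, 1)}, fun i => if i = (2, 1) then Kq07.dWinf else Kq07M3.dWinf,
    fun i => if i = (2, 1) then Kq07.dWb b else Kq07M3.dWb b⟩

/-- **THE NO-WALL CRITERION FAILS ON C** (every `b`): the `(2,1)` member has `δW_∞ < 0` (★ #109 `Kq07.dWinf_neg`).
[cite: Freidberg2014, §11.5.6 eq. (11.151)] -/
theorem noWall_not_criterionHolds (b : ℝ) :
    ¬ (ResistiveSchemas.rwmNoWallSchema (ℕ × ℕ)).CriterionHolds (classData b) := by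
  intro h
  have h21 := h (2, 1) (by simp [ResistiveSchemas.rwmNoWallSchema, classData])
  simp only [ResistiveSchemas.rwmNoWallSchema, classData, if_true] at h21
  linarith [Kq07.dWinf_neg]

/-- … although the `(3,1)` member alone passes it (`Kq07M3.dWinf_pos`). [cite: Freidberg2014, §11.5.6 eq. (11.151)] -/
theorem noWall_31_pos : 0 < (ResistiveSchemas.rwmNoWallSchema (ℕ × ℕ)).μ (classData 1) (3, 1) := by
  simp only [ResistiveSchemas.rwmNoWallSchema, classData]
  norm_num
  exact Kq07M3.dWinf_pos

/-- **THE IDEAL-WALL CRITERION ON C ⇔ `b < b*_{(2,1)}`** for every wall `b > a`: the `(3,1)` member has `δW_b > 0` for every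
`b > a` (`Kq07M3.dWb_pos`), so only the `(2,1)` member binds (`Kq07.dWb_pos_iff`). [cite: Freidberg2014, §11.5.6 p. 491] -/
theorem idealWall_criterionHolds_iff {b : ℝ} (hb : 1 < b) :
    (ResistiveSchemas.rwmIdealWallSchema (ℕ × ℕ)).CriterionHolds (classData b) ↔
      b < Kq07.PK.criticalWallRadius 2 kk 1 Kq07.xi := by
  rw [← Kq07.dWb_pos_iff hb]
  constructor
  · intro h
    have h21 := h (2, 1) (by simp [ResistiveSchemas.rwmIdealWallSchema, classData])
    simpa [ResistiveSchemas.rwmIdealWallSchema, classData] using h21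
  · intro h i hi
    simp only [ResistiveSchemas.rwmIdealWallSchema, classData, Set.mem_insert_iff, Set.mem_singleton_iff] at hi ⊢
    rcases hi with rfl | rfl
    · rw [if_pos rfl]; exact h
    · rw [if_neg (by simp)]; exact Kq07M3.dWb_pos hb

/-- **THE IDEAL-WALL CRITERION HOLDS ON C for every wall `a < b ≤ 31/20·a`** (★ #109″: `31/20·a < b*_{(2,1)}`).
[cite: Freidberg2014, §11.5.6 eq. (11.151)] -/
theorem idealWall_criterionHolds {b : ℝ} (hb1 : 1 < b) (hb2 : b ≤ 31 / 20) :
    (ResistiveSchemas.rwmIdealWallSchema (ℕ × ℕ)).CriterionHolds (classData b) :=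
  (idealWall_criterionHolds_iff hb1).2 (lt_of_le_of_lt hb2 Kq07.criticalWallRadius_bounds_sharp.1)

/-- **… and FAILS for every wall `b ≥ 8/5·a`** (`b*_{(2,1)} < 8/5·a`). [cite: Freidberg2014, §11.5.6 eq. (11.151)] -/
theorem idealWall_not_criterionHolds_far {b : ℝ} (hb : 8 / 5 ≤ b) :
    ¬ (ResistiveSchemas.rwmIdealWallSchema (ℕ × ℕ)).CriterionHolds (classData b) := by
  rw [idealWall_criterionHolds_iff (by linarith)]
  linarith [Kq07.criticalWallRadius_bounds_sharp.2]

/-- **A CERTIFIED POSITIVE MARGIN ON THE TWO-MODE CLASS**: for every wall `a < b ≤ 31/20·a` the explicit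
`m = min(δW_b^{(2,1)}, δW_b^{(3,1)}) > 0` is a margin of MODEL M_RWM,K against C in the ideal-wall schema
(`HasMargin` + `HasPositiveMargin`). [cite: Freidberg2014, §11.5.6 eq. (11.151)] -/
theorem idealWall_hasPositiveMargin {b : ℝ} (hb1 : 1 < b) (hb2 : b ≤ 31 / 20) :
    (ResistiveSchemas.rwmIdealWallSchema (ℕ × ℕ)).HasMargin (classData b) (min (Kq07.dWb b) (Kq07M3.dWb b)) ∧
      (ResistiveSchemas.rwmIdealWallSchema (ℕ × ℕ)).HasPositiveMargin (classData b) := by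
  have h21 : 0 < Kq07.dWb b :=
    (Kq07.dWb_pos_iff hb1).2 (lt_of_le_of_lt hb2 Kq07.criticalWallRadius_bounds_sharp.1)
  have h31 : 0 < Kq07M3.dWb b := Kq07M3.dWb_pos hb1
  have hM : (ResistiveSchemas.rwmIdealWallSchema (ℕ × ℕ)).HasMargin (classData b) (min (Kq07.dWb b) (Kq07M3.dWb b)) := by
    intro i hi
    simp only [ResistiveSchemas.rwmIdealWallSchema, classData, Set.mem_insert_iff, Set.mem_singleton_iff] at hi ⊢
    rcases hi with rfl | rfl
    · rw [if_pos rfl]; exact min_le_left _ _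
    · rw [if_neg (by simp)]; exact min_le_right _ _
  exact ⟨hM, ⟨_, lt_min h21 h31, hM⟩⟩

end Kq07Class

end RwmFRS1

end Summit.Ventures.FusionMHD.Models

end
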